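import Summits.KontsevichZagierPeriods.KontsevichZagierPeriods.Theorems.SoloInformedLeafTransport
import HarnessLib

/-!
# The SMOOTH LEAF: local presentability at a smooth point of the boundary curve

Solo programme `solo-KontsevichZagierPeriods-informed`, session s110, PRES-RAT(2) step (β)-6.

Let `K` be a real-root-closed field of real algebraic numbers, `P/D` a `K`-rational function,
`Ω ⊆ ℝ²` open and `ℚ`-semialgebraic, and `p` a point near which the frontier of `Ω` (inside the
open unit square) lies on the zero set of a `K`-polynomial `C` with `C(p) = 0`, `∇C(p) ≠ 0` and
`D(p) ≠ 0`.  Then `P/D` is LOCALLY PRESENTABLE on `Ω` at `p` (`soloInformed_locPresOn_smooth`):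
for all small grid cells `Z` near `p`, `P/D` is presentable on `Ω ∩ Z`.

Proof.  Transport the cell to the unit square along the grid map (rule (2); the pulled-back data
are again `K`-rational and the pulled-back domain is open semialgebraic with frontier on
`Z(C ∘ Φ)`), where — for `∂C/∂y (p) > 0` and a cell inside the box on which `∂C/∂y > 0` and the
complex implicit branch `A` of `C` through `p` is defined — the transported data form a CELL
BRANCH (`SoloInformedCellBranch`: the sign of `C` on each vertical segment of the box is the sign
of `y − Re A(x)` by strict monotonicity), so THEOREM SMOOTH-UNIT applies.  The case
`∂C/∂y (p) < 0` is that of `−C`, and `∂C/∂x (p) ≠ 0` is reduced to it by the coordinate swap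
(rule (2) along the swap).

References: M. Kontsevich, D. Zagier, *Periods* (2001) §1.2.
-/

noncomputable section

open scoped BigOperators Topology
open MeasureTheory Set Metric
open Literature.NumberTheory.Transcendental Literature.NumberTheory.Transcendental.KZ
open Literature.ModelTheory.ExponentialFields (IsSemialgebraic)

namespace Summit.KontsevichZagierPeriods.KontsevichZagierPeriods.Theorems

variable {n : ℕ} {K : Type*} [Field K] [Algebra K ℝ]

/-! ### The smooth leaf, `∂C/∂y (p) > 0` -/

section Snd

variable [CharZero K]

/-- **SMOOTH LEAF, `∂C/∂y (p) > 0`.** [this work] -/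
theorem soloInformed_locPresOn_smooth_snd_pos
    (hK : ∀ c : K, IsAlgebraic ℚ (algebraMap K ℝ c)) (hKrc : SoloInformedRealRootClosed K)
    (P D C : MvPolynomial (Fin 2) K) {Ω : Set (Fin 2 → ℝ)} (hΩo : IsOpen Ω)
    (hΩ : IsSemialgebraic ℚ Ω) {p : Fin 2 → ℝ} {τ : ℝ} (hτ : 0 < τ)
    (hfr : ∀ z ∈ soloInformedOpenCube 2, dist z p < τ → z ∈ frontier Ω →
      (MvPolynomial.aeval z C : ℝ) = 0)
    (hCp : (MvPolynomial.aeval p C : ℝ) = 0)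
    (hCy : 0 < (MvPolynomial.aeval p (MvPolynomial.pderiv 1 C) : ℝ))
    (hDp : (MvPolynomial.aeval p D : ℝ) ≠ 0) :
    SoloInformedLocPresOn Ω (fun x => (MvPolynomial.aeval x P : ℝ) / MvPolynomial.aeval x D) p := by
  have hp_eq : (![p 0, p 1] : Fin 2 → ℝ) = p := by
    funext i
    fin_cases i <;> rfl
  have hdistC : ∀ x y : ℝ, dist (x : ℂ) (y : ℂ) = |x - y| := fun x y => by
    rw [Complex.dist_eq, ← Complex.ofReal_sub, Complex.norm_real, Real.norm_eq_abs]
  -- radii: `∂C/∂y > 0`, `D ≠ 0`, frontier on `Z(C)`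
  obtain ⟨η₁, hη₁, hη₁b⟩ := Metric.isOpen_iff.1
    (isOpen_lt continuous_const (soloInformed_continuous_aevalK (MvPolynomial.pderiv 1 C))) p hCy
  obtain ⟨η₂, hη₂, hη₂b⟩ := Metric.isOpen_iff.1
    (isOpen_ne_fun (soloInformed_continuous_aevalK D) continuous_const) p hDp
  set R : ℝ := min (min η₁ η₂) τ with hR_def
  have hR : 0 < R := lt_min (lt_min hη₁ hη₂) hτ
  have hRη₁ : R ≤ η₁ := (min_le_left _ _).trans (min_le_left _ _)
  have hRη₂ : R ≤ η₂ := (min_le_left _ _).trans (min_le_right _ _)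
  have hRτ : R ≤ τ := min_le_right _ _
  have hpos : ∀ z : Fin 2 → ℝ, dist z p < R →
      0 < (MvPolynomial.aeval z (MvPolynomial.pderiv 1 C) : ℝ) :=
    fun z hz => hη₁b (mem_ball.2 (lt_of_lt_of_le hz hRη₁))
  have hDne : ∀ z : Fin 2 → ℝ, dist z p < R → (MvPolynomial.aeval z D : ℝ) ≠ 0 :=
    fun z hz => hη₂b (mem_ball.2 (lt_of_lt_of_le hz hRη₂))
  -- the complex implicit branch at `p`
  have h0 : soloInformedEvalC (soloInformedKToC K) C ((p 0 : ℝ) : ℂ) ((p 1 : ℝ) : ℂ) = 0 := by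
    rw [soloInformed_evalC_ofReal, hp_eq, hCp, Complex.ofReal_zero]
  have hd : soloInformedEvalC (soloInformedKToC K) (MvPolynomial.pderiv 1 C)
      ((p 0 : ℝ) : ℂ) ((p 1 : ℝ) : ℂ) ≠ 0 := by
    rw [soloInformed_evalC_ofReal, hp_eq]
    exact_mod_cast hCy.ne'
  obtain ⟨ρ, hρ, δ, -, A, hA, hA0, hzero, -, -, hreal⟩ :=
    soloInformed_exists_cxImplicit (soloInformedKToC K) soloInformed_kToC_im C (p 0) (p 1) h0 hd
  set a : ℝ → ℝ := fun s => (A s).re with ha_def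
  have hmemρ : ∀ s : ℝ, |s - p 0| < ρ → (s : ℂ) ∈ ball ((p 0 : ℝ) : ℂ) ρ := fun s hs => by
    rw [mem_ball, hdistC]
    exact hs
  have hAa : ∀ s : ℝ, |s - p 0| < ρ → A s = ((a s : ℝ) : ℂ) := fun s hs => by
    apply Complex.ext
    · simp [ha_def]
    · rw [Complex.ofReal_im]
      exact hreal s (hmemρ s hs)
  -- continuity of `A` at `p 0`: the branch stays in the box
  have hcont : ContinuousAt A ((p 0 : ℝ) : ℂ) := (hA _ (mem_ball_self hρ)).continuousAt
  obtain ⟨ρ₁, hρ₁, hρ₁b⟩ := Metric.continuousAt_iff.1 hcont R hR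
  have haR : ∀ s : ℝ, |s - p 0| < ρ₁ → |s - p 0| < ρ → |a s - p 1| < R := by
    intro s hs hs'
    have h := hρ₁b (x := (s : ℂ)) (by rw [hdistC]; exact hs)
    rw [hA0, Complex.dist_eq] at h
    have h2 : |(A s - (p 1 : ℂ)).re| ≤ ‖A s - (p 1 : ℂ)‖ := Complex.abs_re_le_norm _
    have h3 : (A s - (p 1 : ℂ)).re = a s - p 1 := by simp [ha_def]
    rw [h3] at h2
    exact lt_of_le_of_lt h2 h
  have hCa : ∀ s : ℝ, |s - p 0| < ρ → (MvPolynomial.aeval ![s, a s] C : ℝ) = 0 := by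
    intro s hs
    have h := hzero (s : ℂ) (hmemρ s hs)
    rw [hAa s hs, soloInformed_evalC_ofReal] at h
    exact_mod_cast h
  -- the radius of local presentability
  set ε : ℝ := min ρ (min ρ₁ R) with hε_def
  have hε : 0 < ε := lt_min hρ (lt_min hρ₁ hR)
  have hερ : ε ≤ ρ := min_le_left _ _
  have hερ₁ : ε ≤ ρ₁ := (min_le_right _ _).trans (min_le_left _ _)
  have hεR : ε ≤ R := (min_le_right _ _).trans (min_le_right _ _)
  -- the sign of `C` on the box `|x − p 0| < ε`, `|y − p 1| < R`
  have hsign : ∀ x y : ℝ, |x - p 0| < ε → |y - p 1| < R →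
      ((0 < (MvPolynomial.aeval ![x, y] C : ℝ)) ↔ a x < y) ∧
        (((MvPolynomial.aeval ![x, y] C : ℝ) < 0) ↔ y < a x) := by
    intro x y hx hy
    refine soloInformed_sign_of_pderiv_pos C (fun t ht => hpos _ ?_)
      (haR x (lt_of_lt_of_le hx hερ₁) (lt_of_lt_of_le hx hερ)) (hCa x (lt_of_lt_of_le hx hερ)) hy
    rw [dist_pi_lt_iff hR]
    intro l
    fin_cases l
    · simpa [Real.dist_eq] using lt_of_lt_of_le hx hεR
    · simpa [Real.dist_eq] using ht
  refine ⟨ε, hε, fun M j hM hZ => ?_⟩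
  -- the cell `Z ⊆ B(p, ε)`; notation
  have hMr : (0 : ℝ) < M := by exact_mod_cast hM
  have hMne : (M : ℝ) ≠ 0 := hMr.ne'
  set Φ := soloInformedGridMap M j with hΦ_def
  have hΦZ : ∀ x ∈ soloInformedCube 2, Φ x ∈ soloInformedGridCell M j := fun x hx => by
    rw [← soloInformed_image_gridMap_cube hM j]
    exact mem_image_of_mem _ hx
  have hΦε : ∀ x ∈ soloInformedCube 2, dist (Φ x) p < ε := fun x hx => mem_ball.1 (hZ (hΦZ x hx))
  have hΦ0 : ∀ x ∈ soloInformedCube 2, |Φ x 0 - p 0| < ε := fun x hx =>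
    lt_of_le_of_lt (by rw [← Real.dist_eq]; exact dist_le_pi_dist _ _ 0) (hΦε x hx)
  have hΦ1 : ∀ x ∈ soloInformedCube 2, |Φ x 1 - p 1| < R := fun x hx =>
    lt_of_le_of_lt (by rw [← Real.dist_eq]; exact dist_le_pi_dist _ _ 1)
      (lt_of_lt_of_le (hΦε x hx) hεR)
  have hvec : ∀ s t : ℝ, s ∈ Icc (0 : ℝ) 1 → t ∈ Icc (0 : ℝ) 1 →
      (![s, t] : Fin 2 → ℝ) ∈ soloInformedCube 2 := fun s t hs ht l => by
    fin_cases l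
    · exact hs
    · exact ht
  -- the cell data
  set c : Fin 2 → ℕ := fun l => (j l : ℕ) with hc_def
  have hmove : ∀ x : Fin 2 → ℝ, soloInformedGridMoveR Finset.univ M c x = Φ x := fun x => by
    rw [soloInformed_gridMoveR_univ]; rfl
  set α : ℝ := ((j 0 : ℕ) : ℝ) / M with hα_def
  set α₁ : ℝ := ((j 1 : ℕ) : ℝ) / M with hα₁_def
  set β : ℝ := (M : ℝ)⁻¹ with hβ_def
  have hΦst0 : ∀ s t : ℝ, Φ ![s, t] 0 = α + β * s := fun s t => by
    simp only [hΦ_def, soloInformedGridMap_apply, Matrix.cons_val_zero, hα_def, hβ_def]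
    field_simp
  have hΦst1 : ∀ s t : ℝ, Φ ![s, t] 1 = α₁ + β * t := fun s t => by
    simp only [hΦ_def, soloInformedGridMap_apply, Matrix.cons_val_one, Matrix.cons_val_fin_one,
      hα₁_def, hβ_def]
    field_simp
  have hΦst : ∀ s t : ℝ, Φ ![s, t] = ![α + β * s, α₁ + β * t] := fun s t => by
    funext l
    fin_cases l
    · exact hΦst0 s t
    · exact hΦst1 s t
  -- the transported polynomial and branch
  set H : MvPolynomial (Fin 2) K := soloInformedGridSubstK Finset.univ M c C with hH_def
  have hHval : ∀ x : Fin 2 → ℝ, (MvPolynomial.aeval x H : ℝ) = MvPolynomial.aeval (Φ x) C :=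
    fun x => by rw [hH_def, soloInformed_aeval_gridSubstK, hmove]
  set V : Set ℂ := soloInformedAffC α β ⁻¹' ball ((p 0 : ℝ) : ℂ) ε with hV_def
  set B : ℂ → ℂ := fun z => (M : ℂ) * A (soloInformedAffC α β z) - ((j 1 : ℕ) : ℂ) with hB_def
  have hVρ : ∀ z ∈ V, soloInformedAffC α β z ∈ ball ((p 0 : ℝ) : ℂ) ρ := fun z hz =>
    ball_subset_ball hερ hz
  have hxε : ∀ s : ℝ, s ∈ Icc (0 : ℝ) 1 → |α + β * s - p 0| < ε := fun s hs => by
    have h := hΦ0 ![s, 0] (hvec s 0 hs ⟨le_rfl, zero_le_one⟩)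
    rwa [hΦst0] at h
  have hmemV : ∀ s : ℝ, s ∈ Icc (0 : ℝ) 1 → ((s : ℝ) : ℂ) ∈ V := fun s hs => by
    show soloInformedAffC α β (s : ℂ) ∈ ball ((p 0 : ℝ) : ℂ) ε
    rw [soloInformed_affC_ofReal, mem_ball, hdistC]
    exact hxε s hs
  have hBre : ∀ s : ℝ, |α + β * s - p 0| < ρ → (B s).re = M * a (α + β * s) - (j 1 : ℕ) := by
    intro s hs
    simp only [hB_def, soloInformed_affC_ofReal, hAa _ hs, Complex.sub_re, Complex.mul_re,
      Complex.natCast_re, Complex.natCast_im, Complex.ofReal_re, Complex.ofReal_im, mul_zero,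
      sub_zero]
  have hiff : ∀ u t : ℝ, (M * u - (j 1 : ℕ) < t ↔ u < α₁ + β * t) ∧
      (t < M * u - (j 1 : ℕ) ↔ α₁ + β * t < u) := by
    intro u t
    have h1 : α₁ + β * t = (((j 1 : ℕ) : ℝ) + t) / M := by
      simp only [hα₁_def, hβ_def]; field_simp
    rw [h1, lt_div_iff₀ hMr, div_lt_iff₀ hMr]
    constructor <;> constructor <;> intro h <;> linarith
  let γ : SoloInformedCellBranch K :=
    { H := H
      A := B
      V := V
      isOpen_V := isOpen_ball.preimage (soloInformed_continuous_affC α β)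
      mem_V := hmemV
      analyticA := by
        intro z hz
        have h1 : AnalyticAt ℂ A (soloInformedAffC α β z) := hA _ (hVρ z hz)
        have h2 : AnalyticAt ℂ (fun z => A (soloInformedAffC α β z)) z :=
          h1.comp (soloInformed_analyticOnNhd_affC α β univ z trivial)
        exact (analyticAt_const.mul h2).sub analyticAt_const
      realA := by
        intro s hs
        have hs' : |α + β * s - p 0| < ρ := by
          have h := hVρ _ hs
          rw [soloInformed_affC_ofReal, mem_ball, hdistC] at h
          exact h
        simp only [hB_def, soloInformed_affC_ofReal, hAa _ hs', Complex.sub_im, Complex.mul_im,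
          Complex.natCast_re, Complex.natCast_im, Complex.ofReal_re, Complex.ofReal_im, mul_zero,
          zero_mul, add_zero, sub_zero]
      zero := by
        intro z hz
        rw [hH_def, soloInformedGridSubstK, soloInformed_evalC_bind₁]
        have hg : (fun i => soloInformedEvalC (soloInformedKToC K)
            ((fun l : Fin 2 => if l ∈ (Finset.univ : Finset (Fin 2)) then
              MvPolynomial.C ((c l : K) / M) + MvPolynomial.C ((M : K)⁻¹) * MvPolynomial.X l
              else MvPolynomial.X l) i) z (B z)) =
            ![soloInformedAffC α β z, A (soloInformedAffC α β z)] := by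
          funext i
          fin_cases i
          · simp [soloInformedEvalC, soloInformedAffC, hα_def, hβ_def, hc_def]
          · have hMc : (M : ℂ) ≠ 0 := by exact_mod_cast hM.ne'
            simp only [Finset.mem_univ, if_true, soloInformedEvalC, Fin.mk_one,
              Matrix.cons_val_one, Matrix.cons_val_fin_one, MvPolynomial.eval₂_add,
              MvPolynomial.eval₂_mul, MvPolynomial.eval₂_C, MvPolynomial.eval₂_X,
              map_div₀, map_natCast, map_inv₀, hB_def, hc_def]
            field_simp
            ring
        rw [hg]
        exact hzero _ (hVρ z hz)
      pos_iff := by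
        intro s t hs ht
        have hsρ : |α + β * s - p 0| < ρ := lt_of_lt_of_le (hxε s hs) hερ
        rw [hHval, hΦst, hBre s hsρ, (hiff _ _).1]
        exact (hsign _ _ (hxε s hs) (by have h := hΦ1 ![s, t] (hvec s t hs ht); rwa [hΦst1] at h)).1
      neg_iff := by
        intro s t hs ht
        have hsρ : |α + β * s - p 0| < ρ := lt_of_lt_of_le (hxε s hs) hερ
        rw [hHval, hΦst, hBre s hsρ, (hiff _ _).2]
        exact (hsign _ _ (hxε s hs) (by have h := hΦ1 ![s, t] (hvec s t hs ht); rwa [hΦst1] at h)).2 }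
  -- the transported domain
  set Ω' : Set (Fin 2 → ℝ) := Φ ⁻¹' Ω with hΩ'_def
  have hΩ'o : IsOpen Ω' := hΩo.preimage (soloInformed_continuous_gridMap M j)
  have hΩ' : IsSemialgebraic ℚ Ω' := soloInformed_isSemialgebraic_preimage_gridMap hΩ M j
  have hfr' : ∀ z ∈ soloInformedOpenCube 2, z ∈ frontier Ω' →
      (MvPolynomial.aeval z γ.H : ℝ) = 0 := by
    intro z hz hzf
    have hzf' : Φ z ∈ frontier Ω :=
      (soloInformed_continuous_gridMap M j).frontier_preimage_subset Ω hzf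
    have hzo : Φ z ∈ soloInformedOpenCube 2 := fun l => by
      have hl := hz l
      have hjl : ((j l : ℕ) : ℝ) + 1 ≤ M := by exact_mod_cast (j l).isLt
      have hj0 : (0 : ℝ) ≤ ((j l : ℕ) : ℝ) := by positivity
      simp only [hΦ_def, soloInformedGridMap_apply]
      constructor
      · exact div_pos (by linarith [hl.1]) hMr
      · rw [div_lt_one hMr]; linarith [hl.2]
    show (MvPolynomial.aeval z H : ℝ) = 0
    rw [hHval]
    exact hfr _ hzo (lt_of_lt_of_le (hΦε z (soloInformedOpenCube_subset_cube 2 hz)) (hεR.trans hRτ))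
      hzf'
  -- the transported integrand
  set P' : MvPolynomial (Fin 2) K :=
    MvPolynomial.C (((M : K)⁻¹) ^ 2) * soloInformedGridSubstK Finset.univ M c P with hP'_def
  set D' : MvPolynomial (Fin 2) K := soloInformedGridSubstK Finset.univ M c D with hD'_def
  have hD' : ∀ y ∈ soloInformedCube 2, (MvPolynomial.aeval y D' : ℝ) ≠ 0 := fun y hy => by
    rw [hD'_def, soloInformed_aeval_gridSubstK, hmove]
    exact hDne _ (lt_of_lt_of_le (hΦε y hy) hεR)
  have hunit := γ.presOn_inter_cube hK hKrc P' D' hD' hΩ'o hΩ' hfr'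
  refine soloInformed_presOn_inter_gridCell_of_pullback hΩ hM j ?_
  refine (soloInformed_presOn_congr fun x _ => ?_).1 hunit
  simp only [hP'_def, hD'_def, map_mul, MvPolynomial.aeval_C, soloInformed_aeval_gridSubstK, hmove,
    map_pow, map_inv₀, map_natCast]
  ring

/-- **SMOOTH LEAF, `∂C/∂y (p) ≠ 0`.** [this work] -/
theorem soloInformed_locPresOn_smooth_snd
    (hK : ∀ c : K, IsAlgebraic ℚ (algebraMap K ℝ c)) (hKrc : SoloInformedRealRootClosed K)
    (P D C : MvPolynomial (Fin 2) K) {Ω : Set (Fin 2 → ℝ)} (hΩo : IsOpen Ω)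
    (hΩ : IsSemialgebraic ℚ Ω) {p : Fin 2 → ℝ} {τ : ℝ} (hτ : 0 < τ)
    (hfr : ∀ z ∈ soloInformedOpenCube 2, dist z p < τ → z ∈ frontier Ω →
      (MvPolynomial.aeval z C : ℝ) = 0)
    (hCp : (MvPolynomial.aeval p C : ℝ) = 0)
    (hCy : (MvPolynomial.aeval p (MvPolynomial.pderiv 1 C) : ℝ) ≠ 0)
    (hDp : (MvPolynomial.aeval p D : ℝ) ≠ 0) :
    SoloInformedLocPresOn Ω (fun x => (MvPolynomial.aeval x P : ℝ) / MvPolynomial.aeval x D) p := by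
  rcases lt_or_gt_of_ne hCy with hneg | hpos
  · refine soloInformed_locPresOn_smooth_snd_pos hK hKrc P D (-C) hΩo hΩ hτ
      (fun z hz hzd hzf => by rw [map_neg, hfr z hz hzd hzf, neg_zero]) (by rw [map_neg, hCp, neg_zero])
      (by rw [map_neg, map_neg]; exact neg_pos.2 hneg) hDp
  · exact soloInformed_locPresOn_smooth_snd_pos hK hKrc P D C hΩo hΩ hτ hfr hCp hpos hDp

/-! ### The smooth leaf, `∂C/∂x (p) ≠ 0`, and the combined statement -/

/-- **SMOOTH LEAF, `∂C/∂x (p) ≠ 0`** (by the coordinate swap). [this work] -/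
theorem soloInformed_locPresOn_smooth_fst
    (hK : ∀ c : K, IsAlgebraic ℚ (algebraMap K ℝ c)) (hKrc : SoloInformedRealRootClosed K)
    (P D C : MvPolynomial (Fin 2) K) {Ω : Set (Fin 2 → ℝ)} (hΩo : IsOpen Ω)
    (hΩ : IsSemialgebraic ℚ Ω) {p : Fin 2 → ℝ} {τ : ℝ} (hτ : 0 < τ)
    (hfr : ∀ z ∈ soloInformedOpenCube 2, dist z p < τ → z ∈ frontier Ω →
      (MvPolynomial.aeval z C : ℝ) = 0)
    (hCp : (MvPolynomial.aeval p C : ℝ) = 0)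
    (hCx : (MvPolynomial.aeval p (MvPolynomial.pderiv 0 C) : ℝ) ≠ 0)
    (hDp : (MvPolynomial.aeval p D : ℝ) ≠ 0) :
    SoloInformedLocPresOn Ω (fun x => (MvPolynomial.aeval x P : ℝ) / MvPolynomial.aeval x D) p := by
  set sw : (Fin 2 → ℝ) → (Fin 2 → ℝ) := fun z => ![z 1, z 0] with hsw
  have hsw2 : ∀ z, sw (sw z) = z := fun z => by
    funext i
    fin_cases i <;> rfl
  have hp' : sw (sw p) = p := hsw2 p
  -- the swapped data
  have hΩ'o : IsOpen (sw ⁻¹' Ω) := hΩo.preimage soloInformed_continuous_swapPt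
  have hcomp : (fun x : Fin 2 → ℝ => x ∘ (Equiv.swap (0 : Fin 2) 1)) = sw := by
    funext x
    funext i
    fin_cases i
    · simp [hsw, Equiv.swap_apply_left]
    · simp [hsw, Equiv.swap_apply_right]
  have hΩ' : IsSemialgebraic ℚ (sw ⁻¹' Ω) := by
    have h := hΩ.preimage_comp (R := ℝ) (Equiv.swap (0 : Fin 2) 1)
    rwa [hcomp] at h
  have hfr' : ∀ z ∈ soloInformedOpenCube 2, dist z (sw p) < τ → z ∈ frontier (sw ⁻¹' Ω) →
      (MvPolynomial.aeval z (soloInformedSwapK C) : ℝ) = 0 := by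
    intro z hz hzd hzf
    rw [soloInformed_frontier_swap_preimage] at hzf
    rw [soloInformed_aeval_swapK]
    have hd := soloInformed_dist_swap_lt hτ hzd
    rw [show (![(sw p) 1, (sw p) 0] : Fin 2 → ℝ) = p from hsw2 p] at hd
    exact hfr _ (soloInformed_swap_mem_openCube hz) hd hzf
  have hCp' : (MvPolynomial.aeval (sw p) (soloInformedSwapK C) : ℝ) = 0 := by
    rw [soloInformed_aeval_swapK]
    show (MvPolynomial.aeval (sw (sw p)) C : ℝ) = 0
    rw [hp', hCp]
  have hCy' : (MvPolynomial.aeval (sw p) (MvPolynomial.pderiv 1 (soloInformedSwapK C)) : ℝ) ≠ 0 := by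
    rw [soloInformed_pderiv_one_swapK, soloInformed_aeval_swapK]
    show (MvPolynomial.aeval (sw (sw p)) (MvPolynomial.pderiv 0 C) : ℝ) ≠ 0
    rw [hp']
    exact hCx
  have hDp' : (MvPolynomial.aeval (sw p) (soloInformedSwapK D) : ℝ) ≠ 0 := by
    rw [soloInformed_aeval_swapK]
    show (MvPolynomial.aeval (sw (sw p)) D : ℝ) ≠ 0
    rw [hp']
    exact hDp
  obtain ⟨ε, hε, hcells⟩ := soloInformed_locPresOn_smooth_snd hK hKrc (soloInformedSwapK P)
    (soloInformedSwapK D) (soloInformedSwapK C) hΩ'o hΩ' hτ hfr' hCp' hCy' hDp'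
  refine ⟨ε, hε, fun M jj hM hZ => ?_⟩
  -- the swapped cell lies in the ball about the swapped point
  have hZ' : soloInformedGridCell M (jj ∘ (Equiv.swap (0 : Fin 2) 1)) ⊆ ball (sw p) ε := by
    intro y hy
    rw [← soloInformed_swap_preimage_gridCell] at hy
    have h := hZ hy
    rw [mem_ball] at h ⊢
    have hd := soloInformed_dist_swap_lt hε h
    rwa [show (![(sw y) 1, (sw y) 0] : Fin 2 → ℝ) = y from hsw2 y] at hd
  have h := hcells M _ hM hZ'
  refine soloInformed_presOn_of_swap (hΩ.inter (isSemialgebraic_soloInformedGridCell M jj)) ?_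
  rw [preimage_inter, soloInformed_swap_preimage_gridCell]
  refine (soloInformed_presOn_congr fun x _ => ?_).1 h
  simp only [soloInformed_aeval_swapK]

/-- **THE SMOOTH LEAF.**  At a point `p` near which the frontier of `Ω` inside the open unit
square lies on `Z(C)`, with `C(p) = 0`, `∇C(p) ≠ 0` and `D(p) ≠ 0`, the `K`-rational function
`P/D` is locally presentable on `Ω`. [this work] -/
theorem soloInformed_locPresOn_smooth
    (hK : ∀ c : K, IsAlgebraic ℚ (algebraMap K ℝ c)) (hKrc : SoloInformedRealRootClosed K)
    (P D C : MvPolynomial (Fin 2) K) {Ω : Set (Fin 2 → ℝ)} (hΩo : IsOpen Ω)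
    (hΩ : IsSemialgebraic ℚ Ω) {p : Fin 2 → ℝ} {τ : ℝ} (hτ : 0 < τ)
    (hfr : ∀ z ∈ soloInformedOpenCube 2, dist z p < τ → z ∈ frontier Ω →
      (MvPolynomial.aeval z C : ℝ) = 0)
    (hCp : (MvPolynomial.aeval p C : ℝ) = 0)
    (hgrad : (MvPolynomial.aeval p (MvPolynomial.pderiv 0 C) : ℝ) ≠ 0 ∨
      (MvPolynomial.aeval p (MvPolynomial.pderiv 1 C) : ℝ) ≠ 0)
    (hDp : (MvPolynomial.aeval p D : ℝ) ≠ 0) :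
    SoloInformedLocPresOn Ω (fun x => (MvPolynomial.aeval x P : ℝ) / MvPolynomial.aeval x D) p := by
  rcases hgrad with hx | hy
  · exact soloInformed_locPresOn_smooth_fst hK hKrc P D C hΩo hΩ hτ hfr hCp hx hDp
  · exact soloInformed_locPresOn_smooth_snd hK hKrc P D C hΩo hΩ hτ hfr hCp hy hDp

end Snd

end Summit.KontsevichZagierPeriods.KontsevichZagierPeriods.Theorems
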